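import Summits.BirchSwinnertonDyer.BirchSwinnertonDyer.Theses.KatoDescentTamePotSupersingular
import Summits.BirchSwinnertonDyer.BirchSwinnertonDyer.Theorems.KatoDescentKMCImpReading
import Summits.BirchSwinnertonDyer.Rank1Residual.O6.X3WildOfKMCTorsionFreeMember
import Summits.BirchSwinnertonDyer.Rank1Residual.Additive.N10IsogenyTransport
import Summits.BirchSwinnertonDyer.Rank1Residual.Additive.PotSupersingularClasses
import HarnessLib

/-!
# Route `KatoDescentTamePotSupersingular` (rung K8-leaf (t′), cell `bsd-potss`): the declared RESIDUAL
# `TameRankOne` (item stmt-BirchSwinnertonDyer-19984) FROM KATO'S MAIN CONJECTURE 12.10 AND PERRIN-RIOU'S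
# RATIO AT THE CLOSED TRIPLE `(IsKatoZetaDescentDatumOf, Kato2004.PRRatio, KatoMainConjectureFine)` —
# duty W1′ optional third (bsd-potss-plan g28; seat `bsd-potss-k8t-c4` g16; `--supports … --as helper`)

WHAT. The siblings `KatoDescentTamePotSupersingularTameRankOneOfKMC.lean` (kmc part 10/14: rank-one descent
at the `p`-torsion-free member over the INTERFACE triple `(IsOf, PRRatio, KMC)` and the iff reading
`ReadsTrivialKMC IsOf KMC`) and `…TameRankOneOfHullKMC.lean` (hull currency, interface `ReadsKMC`) give the
residual BY NAME over interface slots. Cell bsd-cm CLOSED the binders (`Additive/KatoDescentClosedBinders.lean`: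
`IsKatoZetaDescentDatumOf`, `@[conjecture] KatoMainConjectureFine`) and the `→` half of the reading, and
`Theorems/KatoDescentKMCImpReading.lean` §2 proved `rankOne_bsdp_of_kmcFine_of_perrinRiouRatio`:
`KatoMainConjectureFine W p → PerrinRiouUpToUnitAt Kato2004.PRRatio W p → BSDp W p` at a `p`-torsion-free
additive potentially good analytic-rank-one `W`, `p` odd, over the two image-free readings at the CLOSED
triple — NO interface-lemma hypothesis. This file slices it to the (t′) residual: at a (t′) pair `(W, p)`
of analytic rank one, walk to a `p`-torsion-free member `W′ ∼ W` (Mazur–Kenku,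
`Addv.exists_torsionFree_member`), get `BSD(W′, p)` there, and transport it back along the isogeny
(Cassels + GZK + modularity, `N10.bsdp_of_isIsogenous_of_bsdp`); `MissingPPartAt W p` follows
(`missingPPartAt_of_bsdp`, `Ш(W)` finite by GZK).

HONEST LABEL: CONDITIONAL over displayed hypotheses — the two image-free readings
(`TorsionFree.RankOneCountReading`, `TorsionFree.RealizableOfKMC`) at the closed triple, four published facts
(Cassels, GZK, modularity, Mazur–Kenku), and, at every `p`-torsion-free additive potentially good member of
analytic rank one, TWO CONJECTURE-GRADE inputs: Kato's Main Conjecture 12.10 (`KatoMainConjectureFine W′ p`,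
OPEN at an additive prime) and Perrin-Riou's conjecture up to a unit for Kato's ratio
(`PerrinRiouUpToUnitAt Kato2004.PRRatio W′ p`, OPEN; the `p`-adic Gross–Zagier step at an additive
potentially supersingular prime is absent in print). The item 19984 is declared `residual` / open-problem and is
NOT closed by this file; nothing about Kato's Main Conjecture, Perrin-Riou's conjecture or BSD is asserted;
BSD is proved for no curve. Outcome token: «open-problem: KMC 12.10 + PR^× at additive potentially good p on
the rank-one (t′) rows».
[cite: Kato2004Asterisque, Conj. 12.10 (p. 224), §14.14 (p. 243)]
[cite: BurnsKuriharaSano2019, Conj. 1.5 (p. 5), Conj. 2.8 (ii) (p. 10), Thm. 7.6 and Remark 7.7 (p. 29)]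
[cite: Cassels1965ArithmeticVIII] [cite: SilvermanAEC2009, IX.6 Example 6.4] [cite: Miller2011LMS, §1 and Def. 1.1]
-/

set_option autoImplicit false
set_option linter.dupNamespace false

noncomputable section

open scoped Classical

namespace Summit.BirchSwinnertonDyer.BirchSwinnertonDyer.Theorems

open WeierstrassCurve Literature.NumberTheory.EllipticCurves
  Literature.NumberTheory.EllipticCurves.Rank1Residual
  Literature.NumberTheory.EllipticCurves.Rank1Residual.Typed
  Summit.BirchSwinnertonDyer.Rank1Residual.Additive
  Summit.BirchSwinnertonDyer.Rank1Residual
  Summit.BirchSwinnertonDyer.BirchSwinnertonDyer.Theses.KatoDescentTamePotSupersingular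

/-- **§1 `BSD(W, p)` at EVERY additive potentially good analytic-rank-one pair, `p` odd, from KMC 12.10 +
PR^× at the `p`-torsion-free members, CLOSED TRIPLE** — `KatoDescentKMCImpReading.rankOne_bsdp_of_kmcFine_of_perrinRiouRatio`
at a `p`-torsion-free member `W′ ∼ W` (Mazur–Kenku, `Addv.exists_torsionFree_member`), transported back to
`W` by Cassels / GZK / modularity (`N10.bsdp_of_isIsogenous_of_bsdp`). Rational `p`-torsion at `W` itself is
allowed. Conditional; nothing credited. [cite: Kato2004Asterisque, Conj. 12.10 (p. 224)]
[cite: BurnsKuriharaSano2019, Thm. 7.6 (p. 29), Conj. 2.8 (ii) (p. 10)] [cite: Cassels1965ArithmeticVIII]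
[cite: SilvermanAEC2009, IX.6 Example 6.4] -/
theorem potGoodRankOne_bsdp_of_kmcFine_of_perrinRiouRatio
    (hC : TorsionFree.RankOneCountReading IsKatoZetaDescentDatumOf Kato2004.PRRatio)
    (hreal : TorsionFree.RealizableOfKMC IsKatoZetaDescentDatumOf KatoMainConjectureFine)
    (hCassels : bsdRHS_eq_of_isIsogenous) (hGZK : rank_eq_analyticRank_of_analyticRank_le_one)
    (hmod : hasEntireLFunction_rat) (hMK : mazurKenku_exists_cyclic_isogeny)
    (hKP : ∀ (W : WeierstrassCurve ℚ) [W.IsElliptic] [W.IsGloballyMinimal] (p : ℕ) [Fact p.Prime],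
      W.analyticRank = 1 → p ≠ 2 → Addv W p → 0 ≤ padicValRat p W.j → ¬ p ∣ W.torsionOrder →
        KatoMainConjectureFine W p ∧ PerrinRiouUpToUnitAt Kato2004.PRRatio W p)
    (W : WeierstrassCurve ℚ) [W.IsElliptic] [W.IsGloballyMinimal] (p : ℕ) [Fact p.Prime]
    (hr : W.analyticRank = 1) (hp : p ≠ 2) (hadd : Addv W p) (hj : 0 ≤ padicValRat p W.j) :
    BSDp W p := by
  -- a `p`-torsion-free member `W′` of the class (Mazur–Kenku walk), the hypotheses transported to it
  obtain ⟨W', hW', hM', hiso, hadd', hj', ht'⟩ := Addv.exists_torsionFree_member hMK hp hadd hj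
  haveI := hW'
  haveI := hM'
  have hr' : W'.analyticRank = 1 := by rw [← analyticRank_eq_of_isIsogenous' hiso, hr]
  obtain ⟨hkmc', hPR'⟩ := hKP W' p hr' hp hadd' hj' ht'
  -- KMC 12.10 ∧ PR^× ⟹ BSD_p at the torsion-free member over the closed triple, then Cassels back to `W`
  have hbsd' : BSDp W' p :=
    KatoDescentKMCImpReading.rankOne_bsdp_of_kmcFine_of_perrinRiouRatio hC hreal hGZK hmod W' p hr' hp
      hadd' hj' ht' hPR' hkmc'
  exact N10.bsdp_of_isIsogenous_of_bsdp p hCassels hGZK hmod hiso (by rw [hr]) hbsd'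

/-- **§2 The K8-t′ residual `TameRankOne` (item 19984) from KMC 12.10 + PR^× at the CLOSED TRIPLE** —
type = the route decl verbatim: a (t′) pair is an O5 pair (`ClassO5 := ⟨p ≠ 2, Addv, Or.inr SubTprime⟩`,
whence `0 ≤ ord_p j`), §1 gives `BSD(W, p)`, and `MissingPPartAt W p` follows (`Ш(W)` finite by GZK).
NO interface-lemma hypothesis. Conditional over displayed hypotheses (two image-free readings, four
published facts, and the two OPEN conjecture-grade inputs KMC 12.10 / PR^× at the torsion-free rank-one
members); the item is NOT closed; BSD is proved for no curve.
[cite: Kato2004Asterisque, Conj. 12.10 (p. 224), §14.14 (p. 243)]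
[cite: BurnsKuriharaSano2019, Conj. 1.5 (p. 5), Thm. 7.6 (p. 29)] [cite: Miller2011LMS, §1 and Def. 1.1] -/
theorem tameRankOne_of_kmcFine_of_perrinRiouRatio
    (hC : TorsionFree.RankOneCountReading IsKatoZetaDescentDatumOf Kato2004.PRRatio)
    (hreal : TorsionFree.RealizableOfKMC IsKatoZetaDescentDatumOf KatoMainConjectureFine)
    (hCassels : bsdRHS_eq_of_isIsogenous) (hGZK : rank_eq_analyticRank_of_analyticRank_le_one)
    (hmod : hasEntireLFunction_rat) (hMK : mazurKenku_exists_cyclic_isogeny)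
    (hKP : ∀ (W : WeierstrassCurve ℚ) [W.IsElliptic] [W.IsGloballyMinimal] (p : ℕ) [Fact p.Prime],
      W.analyticRank = 1 → p ≠ 2 → Addv W p → 0 ≤ padicValRat p W.j → ¬ p ∣ W.torsionOrder →
        KatoMainConjectureFine W p ∧ PerrinRiouUpToUnitAt Kato2004.PRRatio W p) :
    Summit.BirchSwinnertonDyer.BirchSwinnertonDyer.Theses.KatoDescentTamePotSupersingular.TameRankOne := by
  intro W _ _ p _ hr hp hadd hT
  have hO5 : ClassO5 W p := ⟨hp, hadd, Or.inr hT⟩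
  haveI : Finite W.sha := (hGZK W (by rw [hr])).2
  exact missingPPartAt_of_bsdp W p
    (potGoodRankOne_bsdp_of_kmcFine_of_perrinRiouRatio hC hreal hCassels hGZK hmod hMK hKP W p hr hp hadd
      hO5.padicValRat_j_nonneg)

end Summit.BirchSwinnertonDyer.BirchSwinnertonDyer.Theorems

end
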